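import Mathlib
import Summits.Ventures.DiscreteObjects.Mahler.SmythIsolation

/-!
# Smyth's theorem: the equality case `M(P) = θ₀` (venture `DiscreteObjects`, target L)

Cell `pub-namedobj`, seat `pub-namedobj-mahler` (gen 9). Framing: lottery ticket; floor = certified
bounds/negative ranges.

[McKee–Smyth, *Around the Unit Circle*, Thm 12.1] states that, for monic irreducible nonreciprocal `P`,
`M(P) = θ₀` "precisely for the polynomials `z^{3n} - z^n - 1` and `z^{3n} + z^{2n} - 1` (`n ≥ 1`), as
well as those with `z` replaced by `-z`" (book §12.2.6, p.214–215: in the case `C = c` the comparison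
(12.27) gives `P(z)/Q(z) = P₀(a z^k)/Q₀(a z^k)`).  We prove the DIVISIBILITY form of this classification,
which does not presuppose the irreducibility of those trinomials: for an irreducible `P ∈ ℤ[X]` with
`P(0) ≠ 0`, `P.reverse ≠ ±P`,

  `M(P) = θ₀  ↔  ∃ k ≥ 1, ∃ a = ±1,  P ∣ 1 - X^{2k} + aX^{3k} = P₀(aX^k)  ∨  P ∣ 1 - aX^k + aX^{3k} = Q₀(aX^k)`

(`P₀ = 1 - z² + z³`, `Q₀ = 1 - z + z³`; note `-Q₀(-z^n) = z^{3n} - z^n - 1`, `-P₀(-z^n) = z^{3n} + z^{2n} - 1`).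

* `smyth_isolation_caseB_dichotomy` — the case `ℓ > 2k` re-run with the sharper output
  `εP·Q₀(aX^k) = P*·P₀(aX^k) ∨ M(P) ≥ 1.325` (same proof as `smyth_isolation_caseB`);
* `dvd_of_dvd_reverse_mul` — `P ∣ P*·Q ⇒ P ∣ Q` for irreducible nonreciprocal monic `P`;
* `smyth_equality_of_monic`, `intMahlerMeasure_eq_smythTheta_iff_dvd` — the classification.
-/

namespace Summit.Ventures.DiscreteObjects.Mahler

open Polynomial Metric Set Filter Topology Finset
open scoped ComplexConjugate

noncomputable section

/-! ### Case `ℓ > 2k`, dichotomy form -/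

/-- **Case `ℓ > 2k`, dichotomy form.**  `P` monic, `P(0) = ε = ±1`, `M(P) > 1`,
`εP = P*(1 + aX^k) + X^{2k+1}R` (`a = ±1`, `k ≥ 1`): either `εP·Q₀(aX^k) = P*·P₀(aX^k)` exactly, or
`M(P) ≥ 1.325`. -/
theorem smyth_isolation_caseB_dichotomy {P R : ℤ[X]} (hmonic : P.Monic) {ε : ℤ} (hε : P.coeff 0 = ε)
    (hε1 : ε * ε = 1) {a : ℤ} (ha : a = 1 ∨ a = -1) {k : ℕ} (hk : 1 ≤ k)
    (hid : C ε * P = P.reverse * (1 + C a * X ^ k) + X ^ (2 * k + 1) * R)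
    (hM1 : 1 < intMahlerMeasure P) :
    C ε * P * (1 - C a * X ^ k + C a * X ^ (3 * k)) = P.reverse * (1 - X ^ (2 * k) + C a * X ^ (3 * k)) ∨
      (1325 : ℝ) / 1000 ≤ intMahlerMeasure P := by
  set M := intMahlerMeasure P with hM
  have hMpos : 0 < M := lt_trans one_pos hM1
  have haa : a * a = 1 := by rcases ha with h | h <;> subst h <;> norm_num
  have haR : (a : ℝ) = 1 ∨ (a : ℝ) = -1 := by rcases ha with h | h <;> simp [h]
  have haaR : (a : ℝ) * a = 1 := by exact_mod_cast haa
  -- Smyth data and the relations at orders `k`, `2k`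
  obtain ⟨f, g, c, D, hcM, hfg⟩ := exists_smythData hmonic hε hε1 hM1
  have hid' : C ε * P = P.reverse * (1 + C a * X ^ k) + C 0 * X ^ (2 * k) + X ^ (2 * k + 1) * R := by
    rw [hid, map_zero, zero_mul, add_zero]
  have hrel := smyth_relations_re hmonic hid' D hfg
  by_cases hc : c < 3 / 4
  · right
    have h1 : M⁻¹ < 3 / 4 := hcM ▸ hc
    rw [inv_lt_comm₀ hMpos (by norm_num)] at h1
    norm_num at h1
    linarith
  push Not at hc
  have hrelk : (jetCoeff f k).re = (jetCoeff g k).re + a * c := by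
    have h := hrel k (by omega)
    rw [if_pos le_rfl, if_neg (by omega), Nat.sub_self, D.symm.re_f0] at h
    linarith
  have hrel2k : (jetCoeff f (2 * k)).re = (jetCoeff g (2 * k)).re + a * (jetCoeff g k).re := by
    have h := hrel (2 * k) le_rfl
    rw [if_pos (by omega), if_pos rfl, show 2 * k - k = k by omega] at h
    push_cast at h; linarith
  -- the discrepancy polynomial `D = εP·Q₀(aX^k) - P*·P₀(aX^k)`
  set DZ : ℤ[X] := C ε * P * (1 - C a * X ^ k + C a * X ^ (3 * k)) -
    P.reverse * (1 - X ^ (2 * k) + C a * X ^ (3 * k)) with hDZ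
  by_cases hDz : DZ = 0
  · exact Or.inl (sub_eq_zero.mp hDz)
  right
  -- constants
  obtain ⟨hCCi, hC1, hC2, hCeq⟩ := smythTheta_inv_facts
  set C₀ : ℝ := smythTheta⁻¹ with hC₀
  -- Lemma 12.17
  obtain ⟨hcC, hFk, hGk, hG2k⟩ := smyth_lemma_12_17 haR hc D.clt hC1 hC2 hCeq (D.abs_re_le hk) hrelk hrel2k
    (D.two_mul_bounds hk) (D.symm.two_mul_bounds hk)
  -- the gap `C₀ - c ≥ 2.9·10⁻⁴`
  have hgap : (29 : ℝ) / 100000 ≤ C₀ - c := by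
    by_contra hlt
    push Not at hlt
    have hδ3 : C₀ - c < 1 / 1000 := by linarith
    -- the first nonzero coefficient of `D`, at an index `p ≥ 2k+1`
    have hR : X * R.divX + C (R.coeff 0) = R := by rw [mul_comm]; exact R.divX_mul_X_add
    have hid'' : C ε * P = P.reverse * (1 + C a * X ^ k) + C (R.coeff 0) * X ^ (2 * k + 1) +
        X ^ (2 * k + 1 + 1) * R.divX := by
      rw [hid]; conv_lhs => rw [← hR]
      ring
    have hX : X ^ (2 * k + 1) ∣ DZ := X_pow_dvd_smythD hk le_rfl haa hid''
    set p := DZ.natTrailingDegree with hp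
    have hbelow : ∀ j < p, DZ.coeff j = 0 := fun j hj => coeff_eq_zero_of_lt_natTrailingDegree hj
    have hp2k : 2 * k + 1 ≤ p := le_natTrailingDegree hDz (fun m hm => (X_pow_dvd_iff.mp hX) m hm)
    have hDp : DZ.coeff p ≠ 0 := trailingCoeff_eq_zero.not.mpr hDz
    -- complex side: `Γ = f·Q₀(aX^k)`, `W = g·P₀(aX^k)`, `A = P*·P₀(aX^k)`
    set ar : ℝ := (a : ℝ) with har
    set Q0c : ℂ[X] := C ((1 : ℝ) : ℂ) * X ^ 0 + C ((-ar : ℝ) : ℂ) * X ^ k + C ((ar : ℝ) : ℂ) * X ^ (3 * k)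
      with hQ0c
    set P0c : ℂ[X] := C ((1 : ℝ) : ℂ) * X ^ 0 + C ((-1 : ℝ) : ℂ) * X ^ (2 * k) + C ((ar : ℝ) : ℂ) * X ^ (3 * k)
      with hP0c
    set Pc := P.map (Int.castRingHom ℂ) with hPc
    set Prc := P.reverse.map (Int.castRingHom ℂ) with hPrc
    set Dc := DZ.map (Int.castRingHom ℂ) with hDc
    set A : ℂ[X] := Prc * P0c with hA
    set Γ : ℂ → ℂ := fun z => f z * Q0c.eval z with hΓ
    set W : ℂ → ℂ := fun z => g z * P0c.eval z with hW
    have hΓd : DifferentiableOn ℂ Γ (ball 0 1) := D.hf.differentiableOn.mul Q0c.differentiable.differentiableOn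
    have hWd : DifferentiableOn ℂ W (ball 0 1) := D.hg.differentiableOn.mul P0c.differentiable.differentiableOn
    have hPrc0 : Prc.coeff 0 = 1 := by
      rw [hPrc, coeff_map, coeff_zero_reverse, hmonic.leadingCoeff]; simp
    have hk0 : k ≠ 0 := by omega
    have hP0c0 : P0c.coeff 0 = 1 := by
      rw [hP0c]
      simp only [coeff_add, coeff_C_mul_X_pow, if_true]
      rw [if_neg (by omega), if_neg (by omega)]; simp
    have hA0 : A.coeff 0 = 1 := by rw [hA, mul_coeff_zero, hPrc0, hP0c0, one_mul]
    have hDc0 : ∀ j < p, Dc.coeff j = 0 := fun j hj => by rw [hDc, coeff_map, hbelow j hj]; simp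
    have harC : ((ar : ℝ) : ℂ) = (a : ℂ) := by rw [har]; push_cast; rfl
    have hidfun : ∀ z ∈ ball (0 : ℂ) 1, Γ z * A.eval z = W z * (A.eval z + Dc.eval z) := by
      intro z hz
      have h := hfg z hz
      simp only [hΓ, hW, hA, hDc, hDZ, hQ0c, hP0c, Polynomial.map_sub, Polynomial.map_mul, Polynomial.map_add,
        Polynomial.map_pow, Polynomial.map_one, Polynomial.map_C, Polynomial.map_X]
      simp only [eval_sub, eval_mul, eval_add, eval_pow, eval_one, eval_C, eval_X, eq_intCast, harC]
      rw [← hPc, ← hPrc]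
      push_cast
      linear_combination ((1 : ℂ) - (a : ℂ) * z ^ k + (a : ℂ) * z ^ (3 * k)) *
        ((1 : ℂ) - z ^ (2 * k) + (a : ℂ) * z ^ (3 * k)) * h
    obtain ⟨-, hdiff⟩ := jetCoeff_eq_below_and_at one_pos hΓd hWd A Dc hA0 hDc0 hidfun
    -- `jet_0 W = c`, `Dc_p = D_p`
    have hg0 : g 0 = (c : ℂ) := by rw [← D.g0, jetCoeff_zero]
    have hW0 : jetCoeff W 0 = c := by
      rw [jetCoeff_zero, hW]
      show g 0 * P0c.eval 0 = c
      rw [← coeff_zero_eq_eval_zero, hP0c0, mul_one, hg0]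
    have hDcp : Dc.coeff p = ((DZ.coeff p : ℤ) : ℂ) := by rw [hDc, coeff_map]; simp
    rw [hW0, hDcp] at hdiff
    -- real parts of the jets of `Γ`, `W` at `p`
    set F : ℕ → ℝ := fun n => (jetCoeff f n).re with hFdef
    set G : ℕ → ℝ := fun n => (jetCoeff g n).re with hGdef
    have hF : ∀ n, ((F n : ℝ) : ℂ) = jetCoeff f n := fun n => D.re_f n
    have hG : ∀ n, ((G n : ℝ) : ℂ) = jetCoeff g n := fun n => D.symm.re_f n
    have hΓp : jetCoeff Γ p = ((F p - ar * F (p - k) + (if 3 * k ≤ p then ar * F (p - 3 * k) else 0) : ℝ) : ℂ) := by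
      rw [hΓ, hQ0c, jetCoeff_mul_trinomial_real one_pos D.hf.differentiableOn hF, if_pos (Nat.zero_le p),
        if_pos (by omega : k ≤ p), Nat.sub_zero]
      congr 1
      split_ifs <;> ring
    have hWp : jetCoeff W p = ((G p - G (p - 2 * k) + (if 3 * k ≤ p then ar * G (p - 3 * k) else 0) : ℝ) : ℂ) := by
      rw [hW, hP0c, jetCoeff_mul_trinomial_real one_pos D.hg.differentiableOn hG, if_pos (Nat.zero_le p),
        if_pos (by omega : 2 * k ≤ p), Nat.sub_zero]
      congr 1
      split_ifs <;> ring
    rw [hΓp, hWp] at hdiff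
    have hdiffR : (F p - ar * F (p - k) + (if 3 * k ≤ p then ar * F (p - 3 * k) else 0)) -
        (G p - G (p - 2 * k) + (if 3 * k ≤ p then ar * G (p - 3 * k) else 0)) = c * (DZ.coeff p : ℝ) := by
      exact_mod_cast hdiff
    -- `|γ_p - w_p| ≥ c ≥ 3/4`
    have hbig : 3 / 4 ≤ |(F p - ar * F (p - k) + (if 3 * k ≤ p then ar * F (p - 3 * k) else 0)) -
        (G p - G (p - 2 * k) + (if 3 * k ≤ p then ar * G (p - 3 * k) else 0))| := by
      rw [hdiffR, abs_mul, abs_of_pos D.cpos]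
      have h1 : (1 : ℝ) ≤ |(DZ.coeff p : ℝ)| := by
        rw [← Int.cast_abs]; exact_mod_cast Int.one_le_abs hDp
      nlinarith [D.cpos]
    -- `|γ_p - w_p| ≤ 44 √(C₀ - c)` (Lemmas 12.18, 12.19)
    have hsmall := smyth_12_49 (F := F) (G := G)
      (fco := fun n => F n + if k ≤ n then ar * C₀ * F (n - k) else 0)
      (gco := fun n => smythTheta * G n - (if k ≤ n then ar * (1 + C₀) * G (n - k) else 0) +
        (if 2 * k ≤ n then G (n - 2 * k) else 0))
      hk haR hc hcC hδ3 hC1 hC2 hCeq hCCi D.re_f0 D.symm.re_f0 hFk hGk hG2k (fun n => rfl) (fun n => rfl)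
      (hardy_budget_f D.hf hF haaR hk) (hardy_budget_g D.hg hG haaR hk) hp2k
    -- `√(C₀ - c) ≥ 3/176`
    have hs := le_trans hbig hsmall
    have hs0 : 0 ≤ C₀ - c := sub_nonneg.mpr hcC
    have hsq : Real.sqrt (C₀ - c) ^ 2 = C₀ - c := Real.sq_sqrt hs0
    nlinarith [Real.sqrt_nonneg (C₀ - c)]
  -- from the gap: `c ≤ C₀ - 0.00029 < 0.7547`, so `M = 1/c ≥ 1.325`
  have hcle : c ≤ 7547 / 10000 := by linarith
  have hMc : M = c⁻¹ := by rw [hcM, inv_inv]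
  rw [hMc, le_inv_comm₀ (by norm_num) D.cpos]
  linarith


/-! ### The classification -/

/-- `P ∣ P*·Q ⇒ P ∣ Q` for a monic irreducible `P` with `P(0) = ε = ±1` and `P* ≠ εP`. -/
theorem dvd_of_dvd_reverse_mul {P Q : ℤ[X]} (hmonic : P.Monic) (hirr : Irreducible P) {ε : ℤ}
    (hε : P.coeff 0 = ε) (hε1 : ε * ε = 1) (hne : P.reverse ≠ C ε * P) (hdvd : P ∣ P.reverse * Q) : P ∣ Q := by
  rcases hirr.prime.dvd_or_dvd hdvd with h | h
  · exact absurd (reverse_eq_of_dvd hmonic hε hε1 h) hne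
  · exact h

/-- If `P ≠ 0` divides `Q` then `M(P) ≤ M(Q)` provided `Q ≠ 0`. -/
theorem intMahlerMeasure_le_of_dvd {P Q : ℤ[X]} (hQ : Q ≠ 0) (hdvd : P ∣ Q) :
    intMahlerMeasure P ≤ intMahlerMeasure Q := by
  obtain ⟨q, hq⟩ := hdvd
  have hq0 : q ≠ 0 := by rintro rfl; exact hQ (by rw [hq, mul_zero])
  rw [hq, intMahlerMeasure_mul]
  have h1 : 1 ≤ intMahlerMeasure q := one_le_intMahlerMeasure hq0
  have h0 : 0 ≤ intMahlerMeasure P := by unfold intMahlerMeasure; exact mahlerMeasure_nonneg _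
  nlinarith

/-- **Equality case, monic core.**  `P` monic irreducible, `P(0) = ε = ±1`, `P* ≠ εP`, `M(P) = θ₀` ⟹
`P ∣ P₀(aX^k)` or `P ∣ Q₀(aX^k)` for some `k ≥ 1`, `a = ±1`. -/
theorem smyth_equality_of_monic {P : ℤ[X]} (hmonic : P.Monic) (hirr : Irreducible P) {ε : ℤ}
    (hε : P.coeff 0 = ε) (hε1 : ε * ε = 1) (hne : P.reverse ≠ C ε * P)
    (hM : intMahlerMeasure P = smythTheta) :
    ∃ k : ℕ, 1 ≤ k ∧ ∃ a : ℤ, (a = 1 ∨ a = -1) ∧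
      (P ∣ 1 - X ^ (2 * k) + C a * X ^ (3 * k) ∨ P ∣ 1 - C a * X ^ k + C a * X ^ (3 * k)) := by
  set M := intMahlerMeasure P with hMdef
  have hM1 : 1 < M := by rw [hM]; exact lt_trans (by norm_num) smythTheta_gt
  have hMpos : 0 < M := lt_trans one_pos hM1
  have hθlt := smythTheta_lt
  obtain ⟨hK1, hK2⟩ := sqrt_smyth_gap_const_bounds
  obtain ⟨k, ℓ, a, b, R, hk, hkl, ha, hb, hid⟩ := exists_second_nonpalindromic_coeff hmonic hε hε1 hne
  obtain ⟨f, g, c, D, hcM, hfg⟩ := exists_smythData hmonic hε hε1 hM1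
  have hrel := smyth_relations_re hmonic hid D hfg
  -- `c = 1/θ₀ ≥ 3/4`
  have hc : 3 / 4 ≤ c := by
    rw [hcM, ← hMdef, hM]
    exact le_trans (by norm_num) smythTheta_inv_facts.2.1.le
  have hrelk : (jetCoeff f k).re = (jetCoeff g k).re + a * c := by
    have h := hrel k hkl.le
    rw [if_pos le_rfl, if_neg (by omega), Nat.sub_self, D.symm.re_f0] at h
    linarith
  obtain ⟨ha1, -, -⟩ := smyth_orderK hc (D.abs_re_le hk) (D.symm.abs_re_le hk) ha hrelk
  have hrell : (jetCoeff f ℓ).re = (jetCoeff g ℓ).re + a * (jetCoeff g (ℓ - k)).re + b * c := by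
    have h := hrel ℓ le_rfl
    rw [if_pos hkl.le, if_pos rfl] at h
    exact h
  have hb1 : b = 1 ∨ b = -1 :=
    smyth_b_bound hc ha1 (D.abs_re_le (n := ℓ) (by omega)) (D.symm.abs_re_le (n := ℓ) (by omega))
      (D.symm.abs_re_le (n := ℓ - k) (by omega)) hb hrell
  have haa : a * a = 1 := by rcases ha1 with h | h <;> subst h <;> norm_num
  have hCa : C a * C a = (1 : ℤ[X]) := by rw [← map_mul, haa, map_one]
  have hCε : C ε * C ε = (1 : ℤ[X]) := by rw [← map_mul, hε1, map_one]
  rcases Nat.lt_trichotomy ℓ (2 * k) with hlt | heq | hgt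
  · -- case `ℓ < 2k`: `M ≥ 1.32487 > θ₀`, impossible
    exfalso
    have hc' := smyth_analytic_caseA_exact D hk hkl hlt ha hb hrel
    rw [hcM, inv_inv] at hc'
    linarith
  · -- case `ℓ = 2k`
    subst heq
    rw [show 2 * k - k = k by omega] at hrell
    rcases hb1 with hb1 | hb1
    · -- `b = 1`: pass to `P' = ε P*`
      subst hb1
      rw [map_one, one_mul] at hid
      set P' : ℤ[X] := C ε * P.reverse with hP'
      have hε0 : ε ≠ 0 := by rintro rfl; simp at hε1
      have htr : P.natTrailingDegree = 0 :=
        natTrailingDegree_eq_zero_of_constantCoeff_ne_zero (by rw [constantCoeff_apply, hε]; exact hε0)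
      have hrevrev : P.reverse.reverse = P := by
        have hd : P.reverse.natDegree = P.natDegree := by rw [reverse_natDegree, htr, Nat.sub_zero]
        rw [reverse, hd, reverse, reflect_reflect]
      have hmonic' : P'.Monic := by
        rw [Monic, hP', leadingCoeff_mul, leadingCoeff_C, reverse_leadingCoeff, trailingCoeff, htr, hε, hε1]
      have hε' : P'.coeff 0 = ε := by
        rw [hP', coeff_C_mul, coeff_zero_reverse, hmonic.leadingCoeff, mul_one]
      have hrev' : P'.reverse = C ε * P := by
        rw [hP', reverse_mul_of_domain, reverse_C, hrevrev]
      have hM' : intMahlerMeasure P' = M := by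
        have : P' = P.reverse ∨ P' = -P.reverse := by
          rcases Int.mul_eq_one_iff_eq_one_or_neg_one.mp hε1 with ⟨h, -⟩ | ⟨h, -⟩
          · left; rw [hP', h, map_one, one_mul]
          · right; rw [hP', h, map_neg, map_one, neg_one_mul]
        rcases this with h | h
        · rw [h, intMahlerMeasure_reverse_of_monic hmonic]
        · rw [h, intMahlerMeasure_neg, intMahlerMeasure_reverse_of_monic hmonic]
      have hM1' : 1 < intMahlerMeasure P' := by rw [hM']; exact hM1
      have hS : X * (P.reverse - 1).divX = P.reverse - 1 := by
        have h := (P.reverse - 1).divX_mul_X_add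
        rw [coeff_sub, coeff_zero_reverse, hmonic.leadingCoeff, coeff_one_zero, sub_self, map_zero,
          add_zero, mul_comm] at h
        exact h
      obtain ⟨k', rfl⟩ : ∃ k', k = k' + 1 := ⟨k - 1, by omega⟩
      have hid2 : C ε * P' = P'.reverse * (1 + C (-a) * X ^ (k' + 1)) +
          X ^ (2 * (k' + 1) + 1) * ((P.reverse - 1).divX + C a * X ^ k' - R * (1 - C a * X ^ (k' + 1))) := by
        rw [hrev', hP', map_neg]
        linear_combination (-(1 - C a * X ^ (k' + 1))) * hid - X ^ (2 * (k' + 1)) * hS +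
          P.reverse * hCε + (P.reverse * X ^ (2 * (k' + 1))) * hCa
      have ha1' : (-a) = 1 ∨ (-a) = -1 := by omega
      rcases smyth_isolation_caseB_dichotomy hmonic' hε' hε1 ha1' (by omega) hid2 hM1' with hD | h
      · refine ⟨k' + 1, by omega, -a, ha1', Or.inr ?_⟩
        have hdvd : P ∣ P.reverse * (1 - C (-a) * X ^ (k' + 1) + C (-a) * X ^ (3 * (k' + 1))) := by
          refine ⟨C ε * (1 - X ^ (2 * (k' + 1)) + C (-a) * X ^ (3 * (k' + 1))), ?_⟩
          rw [hrev', hP'] at hD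
          linear_combination hD - (P.reverse * (1 - C (-a) * X ^ (k' + 1) + C (-a) * X ^ (3 * (k' + 1)))) * hCε
        exact dvd_of_dvd_reverse_mul hmonic hirr hε hε1 hne hdvd
      · exfalso; rw [hM'] at h; linarith
    · -- `b = -1` is impossible
      subst hb1
      exfalso
      have haaR : (a : ℝ) * a = 1 := by exact_mod_cast haa
      have hrel2 : (jetCoeff g (2 * k)).re =
          (jetCoeff f (2 * k)).re + ((-a : ℤ) : ℝ) * (jetCoeff f k).re + ((2 : ℤ) : ℝ) * c := by
        push_cast at hrell ⊢
        linear_combination -hrell + (a : ℝ) * hrelk + c * haaR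
      have ha1' : (-a) = 1 ∨ (-a) = -1 := by omega
      have h2 : (2 : ℤ) = 1 ∨ (2 : ℤ) = -1 :=
        smyth_b_bound hc ha1' (D.symm.abs_re_le (n := 2 * k) (by omega))
          (D.abs_re_le (n := 2 * k) (by omega)) (D.abs_re_le (n := k) hk) (by norm_num) hrel2
      omega
  · -- case `ℓ > 2k`
    obtain ⟨m, rfl⟩ : ∃ m, ℓ = 2 * k + 1 + m := ⟨ℓ - (2 * k + 1), by omega⟩
    have hid2 : C ε * P = P.reverse * (1 + C a * X ^ k) +
        X ^ (2 * k + 1) * (C b * X ^ m + X ^ (m + 1) * R) := by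
      rw [hid]; ring
    rcases smyth_isolation_caseB_dichotomy hmonic hε hε1 ha1 hk hid2 hM1 with hD | h
    · refine ⟨k, hk, a, ha1, Or.inl ?_⟩
      have hdvd : P ∣ P.reverse * (1 - X ^ (2 * k) + C a * X ^ (3 * k)) := by
        rw [← hD]; exact Dvd.intro (C ε * (1 - C a * X ^ k + C a * X ^ (3 * k))) (by ring)
      exact dvd_of_dvd_reverse_mul hmonic hirr hε hε1 hne hdvd
    · exfalso; linarith

/-- **Smyth's theorem, the equality case** ([McKee–Smyth, Thm 12.1], divisibility form).  For an
irreducible `P ∈ ℤ[X]` with `P(0) ≠ 0` which is neither reciprocal nor antireciprocal: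
`M(P) = θ₀` iff `P` divides `P₀(aX^k) = 1 - X^{2k} + aX^{3k}` or `Q₀(aX^k) = 1 - aX^k + aX^{3k}` for some
`k ≥ 1` and `a = ±1`. -/
theorem intMahlerMeasure_eq_smythTheta_iff_dvd {P : ℤ[X]} (hirr : Irreducible P) (h0 : P.coeff 0 ≠ 0)
    (h1 : P.reverse ≠ P) (h2 : P.reverse ≠ -P) :
    intMahlerMeasure P = smythTheta ↔ ∃ k : ℕ, 1 ≤ k ∧ ∃ a : ℤ, (a = 1 ∨ a = -1) ∧
      (P ∣ 1 - X ^ (2 * k) + C a * X ^ (3 * k) ∨ P ∣ 1 - C a * X ^ k + C a * X ^ (3 * k)) := by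
  have hP0 : P ≠ 0 := fun h => h0 (by simp [h])
  have hθ2 : smythTheta < 2 := lt_trans smythTheta_lt (by norm_num)
  have hθM : smythTheta ≤ intMahlerMeasure P := intMahlerMeasure_ge_smythTheta_of_nonreciprocal h0 h1 h2
  constructor
  · intro hM
    -- leading coefficient `± 1`, else `M ≥ 2`
    have hlc1 : |P.leadingCoeff| = 1 := by
      have hne : P.leadingCoeff ≠ 0 := leadingCoeff_ne_zero.mpr hP0
      have := Int.one_le_abs hne
      by_contra hc
      have hlc : 2 ≤ |P.leadingCoeff| := by omega
      have h := abs_leadingCoeff_le_intMahlerMeasure P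
      have : (2 : ℝ) ≤ |(P.leadingCoeff : ℝ)| := by exact_mod_cast hlc
      linarith
    -- reduce to the monic case via `P ↦ -P`
    obtain ⟨Q, hQm, hQirr, hQM, hQ0, hQ1, hQ2, hQdvd⟩ : ∃ Q : ℤ[X], Q.Monic ∧ Irreducible Q ∧
        intMahlerMeasure Q = intMahlerMeasure P ∧ Q.coeff 0 ≠ 0 ∧ Q.reverse ≠ Q ∧ Q.reverse ≠ -Q ∧
        ∀ T : ℤ[X], Q ∣ T → P ∣ T := by
      rcases (abs_eq (zero_le_one' ℤ)).mp hlc1 with h | h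
      · exact ⟨P, h, hirr, rfl, h0, h1, h2, fun T hT => hT⟩
      · refine ⟨-P, ?_, ?_, intMahlerMeasure_neg P, by simpa using h0, ?_, ?_, fun T hT => (neg_dvd.mp hT)⟩
        · rw [Monic, leadingCoeff_neg, h, neg_neg]
        · have e : -P = ((-1 : ℤ[X]ˣ) : ℤ[X]) * P := by simp
          rw [e]; exact (irreducible_units_mul _).mpr hirr
        · rw [reverse_neg]; intro h'; exact h1 (neg_injective h')
        · rw [reverse_neg, neg_neg]; intro h'; exact h2 (by rw [← neg_neg P.reverse, h'])
    rw [← hQM] at hM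
    -- constant coefficient `± 1`, else `M ≥ 2`
    have hc1 : |Q.coeff 0| = 1 := by
      have := Int.one_le_abs hQ0
      by_contra hc
      have hc2 : 2 ≤ |Q.coeff 0| := by omega
      have h := abs_coeff_zero_le_intMahlerMeasure hQm
      have : (2 : ℝ) ≤ |(Q.coeff 0 : ℝ)| := by exact_mod_cast hc2
      linarith
    set ε := Q.coeff 0 with hεdef
    have hε1 : ε * ε = 1 := by
      rcases (abs_eq (zero_le_one' ℤ)).mp hc1 with h | h <;> simp [h]
    have hne : Q.reverse ≠ C ε * Q := by
      rcases (abs_eq (zero_le_one' ℤ)).mp hc1 with h | h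
      · rw [h, C_1, one_mul]; exact hQ1
      · rw [h, C_neg, C_1, neg_one_mul]; exact hQ2
    obtain ⟨k, hk, a, ha, hdvd⟩ := smyth_equality_of_monic hQm hQirr rfl hε1 hne hM
    refine ⟨k, hk, a, ha, ?_⟩
    rcases hdvd with h | h
    · exact Or.inl (hQdvd _ h)
    · exact Or.inr (hQdvd _ h)
  · rintro ⟨k, hk, a, ha, hdvd⟩
    apply le_antisymm _ hθM
    have hk0 : k ≠ 0 := by omega
    rcases hdvd with h | h
    · have hQ : (1 - X ^ (2 * k) + C a * X ^ (3 * k) : ℤ[X]) ≠ 0 := by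
        intro h0'
        have := congrArg (fun p : ℤ[X] => p.coeff 0) h0'
        simp only [coeff_add, coeff_sub, coeff_one_zero, coeff_X_pow, coeff_C_mul_X_pow, coeff_zero] at this
        rw [if_neg (by omega), if_neg (by omega)] at this
        norm_num at this
      have hle := intMahlerMeasure_le_of_dvd hQ h
      rwa [intMahlerMeasure_smythP0a ha hk] at hle
    · have hQ : (1 - C a * X ^ k + C a * X ^ (3 * k) : ℤ[X]) ≠ 0 := by
        intro h0'
        have := congrArg (fun p : ℤ[X] => p.coeff 0) h0'
        simp only [coeff_add, coeff_sub, coeff_one_zero, coeff_C_mul_X_pow, coeff_zero] at this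
        rw [if_neg (by omega), if_neg (by omega)] at this
        norm_num at this
      have hle := intMahlerMeasure_le_of_dvd hQ h
      rwa [intMahlerMeasure_smythQ0a ha hk] at hle

end

end Summit.Ventures.DiscreteObjects.Mahler
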